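import Summits.QuantumFields.BalabanUV.T4Continuum.Support.NE7K1LinTorusSymbolReal

/-!
# NE7K1LinTorusJensen — row NE7 (node U5), candidate route HOM, path H1L, cell K1-lin(s): (K2)♯ ON THE DOUBLED TORUS,
# THE COUNT — torus Jensen with constant ONE `L^{d+1}·Σ_b (V(b+e_μ) − V(b))² ≤ L²·Σ_x (φ(x+e_μ) − φ(x))²` and the quadratic
# form of the periodic operator (NEEDS-ESTIMATE #E1, B-E1's clause (c′), lower half of the window — the count)

Lineage `b2b-balaban-t4-ne7-p2` (CRUX PROVER NE7 #2), generation 73; file 39.  On Neumann boxes the sharp lower two-run comparison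
`P_A ⪯ P_B^{Schur}` is `NE7K1LinTwoRunJensen.runA_form_le_schurB_sharp` (straight-line Jensen count, lens 2's (K2)♯ LEMMA W).  THIS
FILE is its TORUS TWIN at `a = 0`, where translation invariance REPLACES the line bookkeeping: the multiplicity count «each fine bond
is used `L` times» becomes «`x ↦ x + m·e_μ` is a bijection of the torus».

* §1 kit on representatives `boxDom (dbl N)`: sums over nearest neighbours (`sum_nbrs`), `Σ_y tadj(x,y)g(y) = Σ_{z~x} g(z mod 2N)`
  (`sum_tadj_mul`), shifts are bijections (`sum_shift`), the quadratic form of the periodic operator at `a = 0`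
  **`torOpK_zero_form`** `⟨φ, torOpK n 0 N φ⟩ = n²·Σ_μ Σ_x (φ(x + e_μ) − φ(x))²`.
* §2 **TORUS JENSEN, CONSTANT ONE** (`jensen_dir`): for `φ` on the fine torus `(ℤ∕2LK)^{d+1}` with `L`-block sums `L^{d+1}V_b`,
  per direction `L^{d+1}·Σ_b (V(b + e_μ) − V(b))² ≤ L²·Σ_x (φ(x + e_μ) − φ(x))²` — telescoping `φ(x + Le_μ) − φ(x)` along `m < L`,
  Cauchy–Schwarz over the `L^{d+1}·L` increments of a block, and `Σ_x g(x + m e_μ)² = Σ_x g(x)²`.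
(File 40 `NE7K1LinTorusFloor` draws the consequences: `n²(−Δ^𝕋_c) ⪯ H_B^𝕋 ∕ Schur(H_B^𝕋) ∕ T^𝕋(s)` and B-E1's floor
`σ_NN(p) ≤ σ_s(p)`.)

HONEST FRAMING: [folklore] (finite bookkeeping + one Cauchy–Schwarz); `a = 0`; constant ONE as on boxes; no estimate of Bałaban's;
no `sorry`.  Census only (toward B-E1's clause (c′), lower half, on the finite doubled torus); NE7 NOT PRINTED ∕ NOT PROVED; spine 0∕9;
FIXED FINITE T⁴, rung (B)+1; NOT infinite volume, NOT mass gap, NOT Clay.  HONEST DEPENDENCY: continuum YM on T⁴ ⇐ BetaPertH ∧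
nine spine estimates (0/9 proved); BetaPertH ⇐ (D1) ∧ (D4) ∧ CAP+tail; G-an2-4 gates asym, D1 and NE2/3/4.
-/

noncomputable section

open Finset Matrix Complex

namespace Summit.QuantumFields.BalabanUV.T4Continuum.NE7K1LinTorusJensen

open Literature.MathematicalPhysics.QuantumFieldTheory.Balaban1983to89
open Literature.MathematicalPhysics.QuantumFieldTheory.Balaban1983to89.B4Reflection242
open Literature.MathematicalPhysics.QuantumFieldTheory.Balaban1983to89.B4BoxCov237 (uvec)
open Literature.MathematicalPhysics.QuantumFieldTheory.Balaban1983to89.B4Lower18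
open Literature.MathematicalPhysics.QuantumFieldTheory.Balaban1983to89.B4TorusPositivity (wrap wrap_wrap_add)
open Literature.MathematicalPhysics.QuantumFieldTheory.Balaban1983to89.B4TwoBox120 (blk_add_mul)
open Literature.MathematicalPhysics.QuantumFieldTheory.Balaban1983to89.Beta.CombesThomasForm (lap lap_apply lap_form)
open NE7K1LinFoldKernels NE7K1LinFoldMatrices NE7K1LinSchurFold NE7K1LinTorusChart NE7K1LinSchurFoldBox
  NE7K1LinTorusLineInvariant NE7K1LinTorusLineSymbol NE7K1LinTorusSymbolReal NE7K1LinBlockCoords NE7K1LinSchurLineU1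
  NE7K1LinSchurLineForm NE7K1LinTwoRunKit

variable {d : ℕ}

/-! ### §1 Kit: neighbour sums, shifts, the quadratic form of the periodic operator at `a = 0` -/

section Kit

variable {N : Fin (d + 1) → ℕ}

/-- sums over the `2(d+1)` nearest neighbours, direction by direction. [folklore] -/
theorem sum_nbrs (x : Fin (d + 1) → ℤ) (f : (Fin (d + 1) → ℤ) → ℝ) :
    ∑ z ∈ nbrs x, f z = ∑ μ : Fin (d + 1), (f (x + uvec μ) + f (x - uvec μ)) := by
  classical
  have hinj₁ : Function.Injective fun i : Fin (d + 1) => x + Pi.single i (1 : ℤ) := by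
    intro i j h
    by_contra hij
    have := congrFun h i
    simp [hij] at this
  have hinj₂ : Function.Injective fun i : Fin (d + 1) => x - Pi.single i (1 : ℤ) := by
    intro i j h
    by_contra hij
    have := congrFun h i
    simp [hij] at this
  have hdisj : Disjoint (Finset.univ.image fun i => x + Pi.single i (1 : ℤ))
      (Finset.univ.image fun i => x - Pi.single i (1 : ℤ)) := by
    rw [Finset.disjoint_left]
    intro z hz hz'
    simp only [Finset.mem_image, Finset.mem_univ, true_and] at hz hz'
    obtain ⟨i, rfl⟩ := hz
    obtain ⟨j, hj⟩ := hz'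
    have := congrFun hj i
    by_cases hij : j = i
    · subst hij; simp at this; omega
    · simp [Ne.symm hij] at this
  unfold nbrs
  rw [Finset.sum_union hdisj, Finset.sum_image fun i _ j _ h => hinj₁ h, Finset.sum_image fun i _ j _ h => hinj₂ h,
    ← Finset.sum_add_distrib]
  rfl

/-- `Σ_y tadj(x,y)·g(y) = Σ_{z ~ x} g(z mod 2N)` on representatives. [folklore] -/
theorem sum_tadj_mul (hN : ∀ i, 1 ≤ N i) (x : ↥(boxDom (dbl N))) (g : ↥(boxDom (dbl N)) → ℝ) :
    ∑ y : ↥(boxDom (dbl N)), (tadj N x.1 y.1 : ℝ) * g y =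
      ∑ z ∈ nbrs x.1, g ⟨wrap (dbl N) z, wrap_mem_boxDom (dbl_pos hN) z⟩ := by
  classical
  simp_rw [tadj_eq_sum, Finset.sum_mul]
  rw [Finset.sum_comm]
  refine Finset.sum_congr rfl fun z _ => ?_
  rw [Finset.sum_eq_single ⟨wrap (dbl N) z, wrap_mem_boxDom (dbl_pos hN) z⟩]
  · simp
  · intro y _ hy
    have : wrap (dbl N) z ≠ y.1 := fun e => hy (Subtype.ext e.symm)
    simp [this]
  · intro h; exact absurd (Finset.mem_univ _) h

/-- **SHIFTS ARE BIJECTIONS OF THE TORUS**: `Σ_x f(x + v mod P) = Σ_x f(x)`. [folklore] -/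
theorem sum_shift {P : Fin (d + 1) → ℕ} (hP : ∀ i, 1 ≤ P i) (f : ↥(boxDom P) → ℝ) (v : Fin (d + 1) → ℤ) :
    ∑ x : ↥(boxDom P), f ⟨wrap P (x.1 + v), wrap_mem_boxDom hP _⟩ = ∑ x : ↥(boxDom P), f x := by
  refine Fintype.sum_equiv (shiftEquiv hP (-v)) _ _ fun x => ?_
  simp only [shiftEquiv, Equiv.coe_fn_mk, sub_neg_eq_add]

/-- the Dirichlet sum of the periodised adjacency, direction by direction:
`Σ_x Σ_y tadj(x,y)(φ_x − φ_y)² = 2·Σ_μ Σ_x (φ(x + e_μ) − φ(x))²`. [folklore] -/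
theorem dirichlet_tadj_eq (hN : ∀ i, 1 ≤ N i) (φ : ↥(boxDom (dbl N)) → ℝ) :
    ∑ x : ↥(boxDom (dbl N)), ∑ y : ↥(boxDom (dbl N)), (tadj N x.1 y.1 : ℝ) * (φ x - φ y) ^ 2 =
      2 * ∑ μ : Fin (d + 1), ∑ x : ↥(boxDom (dbl N)),
        (φ ⟨wrap (dbl N) (x.1 + uvec μ), wrap_mem_boxDom (dbl_pos hN) _⟩ - φ x) ^ 2 := by
  have hP := dbl_pos hN
  have h1 : ∀ x : ↥(boxDom (dbl N)), ∑ y : ↥(boxDom (dbl N)), (tadj N x.1 y.1 : ℝ) * (φ x - φ y) ^ 2 =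
      ∑ μ : Fin (d + 1), ((φ x - φ ⟨wrap (dbl N) (x.1 + uvec μ), wrap_mem_boxDom hP _⟩) ^ 2 +
        (φ x - φ ⟨wrap (dbl N) (x.1 - uvec μ), wrap_mem_boxDom hP _⟩) ^ 2) := by
    intro x
    rw [sum_tadj_mul hN x (fun y => (φ x - φ y) ^ 2), sum_nbrs]
  simp_rw [h1]
  rw [Finset.sum_comm, Finset.mul_sum]
  refine Finset.sum_congr rfl fun μ _ => ?_
  rw [Finset.sum_add_distrib]
  -- the `−e_μ` sum is the `+e_μ` sum read at `x − e_μ`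
  have h2 : ∑ x : ↥(boxDom (dbl N)), (φ x - φ ⟨wrap (dbl N) (x.1 - uvec μ), wrap_mem_boxDom hP _⟩) ^ 2 =
      ∑ x : ↥(boxDom (dbl N)), (φ ⟨wrap (dbl N) (x.1 + uvec μ), wrap_mem_boxDom hP _⟩ - φ x) ^ 2 := by
    rw [← sum_shift hP (fun x => (φ x - φ ⟨wrap (dbl N) (x.1 - uvec μ), wrap_mem_boxDom hP _⟩) ^ 2) (uvec μ)]
    refine Finset.sum_congr rfl fun x _ => ?_
    have e : (⟨wrap (dbl N) ((⟨wrap (dbl N) (x.1 + uvec μ), wrap_mem_boxDom hP _⟩ : ↥(boxDom (dbl N))).1 - uvec μ),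
        wrap_mem_boxDom hP _⟩ : ↥(boxDom (dbl N))) = x := by
      apply Subtype.ext
      show wrap (dbl N) (wrap (dbl N) (x.1 + uvec μ) - uvec μ) = x.1
      rw [sub_eq_add_neg, wrap_wrap_add, add_neg_cancel_right, wrap_eq_self x.2]
    rw [e]
  have h3 : ∑ x : ↥(boxDom (dbl N)), (φ x - φ ⟨wrap (dbl N) (x.1 + uvec μ), wrap_mem_boxDom hP _⟩) ^ 2 =
      ∑ x : ↥(boxDom (dbl N)), (φ ⟨wrap (dbl N) (x.1 + uvec μ), wrap_mem_boxDom hP _⟩ - φ x) ^ 2 :=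
    Finset.sum_congr rfl fun x _ => by ring
  rw [h2, h3]
  ring

/-- **THE QUADRATIC FORM OF THE PERIODIC OPERATOR AT `a = 0`**:
`⟨φ, torOpK n 0 N φ⟩ = n²·Σ_μ Σ_x (φ(x + e_μ) − φ(x))²`. [folklore] -/
theorem torOpK_zero_form (n : ℕ) (hN : ∀ i, 1 ≤ N i) {F : Finset (Fin (d + 1) → ℤ)} (hF : F = boxDom (dbl N)) (φ : ↥F → ℝ) :
    φ ⬝ᵥ torOpK n 0 N F *ᵥ φ =
      (n : ℝ) ^ 2 * ∑ μ : Fin (d + 1), ∑ x : ↥F,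
        (φ ⟨wrap (dbl N) (x.1 + uvec μ), by subst hF; exact wrap_mem_boxDom (dbl_pos hN) _⟩ - φ x) ^ 2 := by
  subst hF
  -- `torOpK n 0 N = n²·lap(tadj)`
  have hlap : torOpK n 0 N (boxDom (dbl N)) = (n : ℝ) ^ 2 • lap (fun x y : ↥(boxDom (dbl N)) => (tadj N x.1 y.1 : ℝ)) := by
    ext x y
    rw [torOpK_apply, Matrix.smul_apply, lap_apply, sum_tadj_real hN x, smul_eq_mul]
    simp
  rw [hlap, smul_mulVec, dotProduct_smul, smul_eq_mul,
    lap_form (fun x y : ↥(boxDom (dbl N)) => (tadj N x.1 y.1 : ℝ)) (fun x y => by exact_mod_cast tadj_comm x.2 y.2) φ,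
    dirichlet_tadj_eq hN φ]
  ring

/-- the periodic operator at `a = 0` is a non-negative form. [folklore] -/
theorem torOpK_zero_form_nonneg (n : ℕ) (hN : ∀ i, 1 ≤ N i) {F : Finset (Fin (d + 1) → ℤ)} (hF : F = boxDom (dbl N))
    (φ : ↥F → ℝ) : 0 ≤ φ ⬝ᵥ torOpK n 0 N F *ᵥ φ := by
  rw [torOpK_zero_form n hN hF φ]
  exact mul_nonneg (sq_nonneg _) (Finset.sum_nonneg fun _ _ => Finset.sum_nonneg fun _ _ => sq_nonneg _)

end Kit

/-! ### §2 Torus Jensen with constant one -/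

section Jensen

variable {L : ℕ} [NeZero L] {K : Fin (d + 1) → ℕ}

/-- the fine torus `(ℤ∕2LK)^{d+1}` has positive sides. [folklore] -/
theorem fine_pos (hK : ∀ i, 1 ≤ K i) : ∀ i, 1 ≤ dbl (fun i => L * K i) i :=
  dbl_pos (mul_pos_side (NeZero.one_le : 1 ≤ L) hK)

/-- shifted coarse labels are labels. [folklore] -/
theorem wrap_mem_labels (hK : ∀ i, 1 ≤ K i) (z : Fin (d + 1) → ℤ) :
    wrap (dbl K) z ∈ (boxDom (dbl fun i => L * K i)).image (blk L) := by
  rw [image_blk_dbl (NeZero.one_le : 1 ≤ L) K]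
  exact wrap_mem_boxDom (dbl_pos hK) z

/-- labels are coarse representatives. [folklore] -/
theorem mem_dbl_of_label {b : Fin (d + 1) → ℤ} (hb : b ∈ (boxDom (dbl fun i => L * K i)).image (blk L)) :
    b ∈ boxDom (dbl K) := by
  rw [image_blk_dbl (NeZero.one_le : 1 ≤ L) K] at hb
  exact hb

/-- **THE BLOCK LABEL OF A SHIFTED POINT**: `blk_L (x + L·v mod 2LK) = (blk_L x + v) mod 2K`. [folklore] -/
theorem blk_wrap_add_mul (hK : ∀ i, 1 ≤ K i) (x v : Fin (d + 1) → ℤ) :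
    blk L (wrap (dbl fun i => L * K i) (x + fun i => (L : ℤ) * v i)) = wrap (dbl K) (blk L x + v) := by
  rw [dbl_mul, blk_wrap (NeZero.one_le : 1 ≤ L) (dbl_pos hK), blk_add_mul (NeZero.one_le : 1 ≤ L)]

/-- the block of the point shifted by `L·v` is the block label shifted by `v`. [folklore] -/
theorem rblk_shift_iff (hK : ∀ i, 1 ≤ K i) (x : ↥(boxDom (dbl fun i => L * K i)))
    (b : ↥((boxDom (dbl fun i => L * K i)).image (blk L))) (v : Fin (d + 1) → ℤ) :
    rblk L _ ⟨wrap (dbl fun i => L * K i) (x.1 + fun i => (L : ℤ) * v i), wrap_mem_boxDom (fine_pos hK) _⟩ =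
        (⟨wrap (dbl K) (b.1 + v), wrap_mem_labels hK _⟩ : ↥((boxDom (dbl fun i => L * K i)).image (blk L))) ↔
      rblk L _ x = b := by
  rw [Subtype.ext_iff, Subtype.ext_iff]
  show blk L (wrap (dbl fun i => L * K i) (x.1 + fun i => (L : ℤ) * v i)) = wrap (dbl K) (b.1 + v) ↔ blk L x.1 = b.1
  rw [blk_wrap_add_mul hK]
  have hbx : blk L x.1 ∈ boxDom (dbl K) := mem_dbl_of_label (Finset.mem_image_of_mem _ x.2)
  have hb : b.1 ∈ boxDom (dbl K) := mem_dbl_of_label b.2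
  constructor
  · intro h
    have h2 := (wrap_add_eq_iff hbx (wrap_mem_boxDom (dbl_pos hK) _)).1 h
    rw [sub_eq_add_neg, wrap_wrap_add, add_neg_cancel_right, wrap_eq_self hb] at h2
    exact h2.symm
  · intro h; rw [h]

/-- **THE COARSE DIFFERENCE AS A BLOCK SUM OF FINE `L`-STEP DIFFERENCES**: for `φ` with block sums `L^{d+1}V_b`,
`L^{d+1}·(V(b + v) − V(b)) = Σ_{x ∈ block b} (φ(x + L·v) − φ(x))`. [folklore] -/
theorem coarse_diff_eq (hK : ∀ i, 1 ≤ K i) (φ : ↥(boxDom (dbl fun i => L * K i)) → ℝ)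
    (V : ↥((boxDom (dbl fun i => L * K i)).image (blk L)) → ℝ)
    (hφ : ∀ b, ∑ x ∈ Finset.univ.filter (fun x => rblk L _ x = b), φ x = (L : ℝ) ^ (d + 1) * V b)
    (b : ↥((boxDom (dbl fun i => L * K i)).image (blk L))) (v : Fin (d + 1) → ℤ) :
    (L : ℝ) ^ (d + 1) * (V ⟨wrap (dbl K) (b.1 + v), wrap_mem_labels hK _⟩ - V b) =
      ∑ x ∈ Finset.univ.filter (fun x => rblk L _ x = b),
        (φ ⟨wrap (dbl fun i => L * K i) (x.1 + fun i => (L : ℤ) * v i), wrap_mem_boxDom (fine_pos hK) _⟩ - φ x) := by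
  classical
  rw [Finset.sum_sub_distrib, mul_sub, ← hφ b, ← hφ ⟨wrap (dbl K) (b.1 + v), wrap_mem_labels hK _⟩]
  congr 1
  -- reindex the block `b + v` by the shift `x ↦ x + L·v`
  rw [Finset.sum_filter, Finset.sum_filter,
    ← sum_shift (fine_pos hK) (fun x => if rblk L _ x = ⟨wrap (dbl K) (b.1 + v), wrap_mem_labels hK _⟩ then φ x else 0)
      (fun i => (L : ℤ) * v i)]
  refine Finset.sum_congr rfl fun x _ => ?_
  simp only [rblk_shift_iff hK x b v]

/-- **TORUS JENSEN, ONE DIRECTION, CONSTANT ONE**: for `φ` on the fine torus with `L`-block sums `L^{d+1}V_b`,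
`L^{d+1}·Σ_b (V(b + e_μ) − V(b))² ≤ L²·Σ_x (φ(x + e_μ) − φ(x))²`. [folklore] -/
theorem jensen_dir (hK : ∀ i, 1 ≤ K i) (φ : ↥(boxDom (dbl fun i => L * K i)) → ℝ)
    (V : ↥((boxDom (dbl fun i => L * K i)).image (blk L)) → ℝ)
    (hφ : ∀ b, ∑ x ∈ Finset.univ.filter (fun x => rblk L _ x = b), φ x = (L : ℝ) ^ (d + 1) * V b) (μ : Fin (d + 1)) :
    (L : ℝ) ^ (d + 1) * ∑ b : ↥((boxDom (dbl fun i => L * K i)).image (blk L)),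
        (V ⟨wrap (dbl K) (b.1 + uvec μ), wrap_mem_labels hK _⟩ - V b) ^ 2 ≤
      (L : ℝ) ^ 2 * ∑ x : ↥(boxDom (dbl fun i => L * K i)),
        (φ ⟨wrap (dbl fun i => L * K i) (x.1 + uvec μ), wrap_mem_boxDom (fine_pos hK) _⟩ - φ x) ^ 2 := by
  classical
  have hL : 1 ≤ L := NeZero.one_le
  have hP := fine_pos (L := L) hK
  have hLpos : (0 : ℝ) < L := by exact_mod_cast hL
  have hLpow : (0 : ℝ) < (L : ℝ) ^ (d + 1) := pow_pos hLpos _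
  have hTL : IsBlockUnion L (boxDom (dbl fun i => L * K i)) := by
    rw [dbl_mul]; exact boxDom_isBlockUnion hL _
  -- the shift by `m` steps and the one-step increment `g`
  set sh : ℕ → ↥(boxDom (dbl fun i => L * K i)) → ↥(boxDom (dbl fun i => L * K i)) :=
    fun m x => ⟨wrap (dbl fun i => L * K i) (x.1 + fun i => (m : ℤ) * uvec μ i), wrap_mem_boxDom hP _⟩ with hsh
  set g : ↥(boxDom (dbl fun i => L * K i)) → ℝ :=
    fun x => φ ⟨wrap (dbl fun i => L * K i) (x.1 + uvec μ), wrap_mem_boxDom hP _⟩ - φ x with hg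
  have hsh0 : ∀ x, sh 0 x = x := fun x => by
    apply Subtype.ext
    show wrap (dbl fun i => L * K i) (x.1 + fun i => ((0 : ℕ) : ℤ) * uvec μ i) = x.1
    have : (x.1 + fun i => ((0 : ℕ) : ℤ) * uvec μ i) = x.1 := by funext i; simp
    rw [this, wrap_eq_self x.2]
  have hsh_succ : ∀ m x, (⟨wrap (dbl fun i => L * K i) ((sh m x).1 + uvec μ), wrap_mem_boxDom hP _⟩ :
      ↥(boxDom (dbl fun i => L * K i))) = sh (m + 1) x := fun m x => by
    apply Subtype.ext
    show wrap (dbl fun i => L * K i) (wrap (dbl fun i => L * K i) (x.1 + fun i => (m : ℤ) * uvec μ i) + uvec μ) =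
      wrap (dbl fun i => L * K i) (x.1 + fun i => ((m + 1 : ℕ) : ℤ) * uvec μ i)
    rw [wrap_wrap_add]
    congr 1
    funext i
    simp only [Pi.add_apply]
    push_cast
    ring
  -- (1) telescoping: `φ(x + L e_μ) − φ(x) = Σ_{m<L} g(sh m x)`
  have htel : ∀ x, φ ⟨wrap (dbl fun i => L * K i) (x.1 + fun i => (L : ℤ) * uvec μ i), wrap_mem_boxDom hP _⟩ - φ x =
      ∑ m ∈ Finset.range L, g (sh m x) := by
    intro x
    have h := Finset.sum_range_sub (fun m => φ (sh m x)) L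
    have e : ∀ m, φ (sh (m + 1) x) - φ (sh m x) = g (sh m x) := fun m => by rw [hg, ← hsh_succ m x]
    simp_rw [e] at h
    rw [h, hsh0]
  -- (2) one block: Cauchy–Schwarz over the `L^{d+1}·L` increments
  have hblock : ∀ b : ↥((boxDom (dbl fun i => L * K i)).image (blk L)),
      ((L : ℝ) ^ (d + 1)) ^ 2 * (V ⟨wrap (dbl K) (b.1 + uvec μ), wrap_mem_labels hK _⟩ - V b) ^ 2 ≤
        ((L : ℝ) ^ (d + 1) * L) * ∑ x ∈ Finset.univ.filter (fun x => rblk L _ x = b), ∑ m ∈ Finset.range L,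
          g (sh m x) ^ 2 := by
    intro b
    have hdiff := coarse_diff_eq hK φ V hφ b (uvec μ)
    simp_rw [htel] at hdiff
    have hCS : (∑ x ∈ Finset.univ.filter (fun x => rblk L _ x = b), ∑ m ∈ Finset.range L, g (sh m x)) ^ 2 ≤
        ((L : ℝ) ^ (d + 1) * L) * ∑ x ∈ Finset.univ.filter (fun x => rblk L _ x = b), ∑ m ∈ Finset.range L,
          g (sh m x) ^ 2 := by
      rw [← Finset.sum_product' _ (Finset.range L) (fun x m => g (sh m x)),
        ← Finset.sum_product' _ (Finset.range L) (fun x m => g (sh m x) ^ 2)]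
      refine sq_sum_le_card_mul_sum_sq.trans (le_of_eq ?_)
      rw [Finset.card_product, card_filter_rblk hL hTL b, Finset.card_range]
      push_cast
      ring
    calc ((L : ℝ) ^ (d + 1)) ^ 2 * (V ⟨wrap (dbl K) (b.1 + uvec μ), wrap_mem_labels hK _⟩ - V b) ^ 2
        = ((L : ℝ) ^ (d + 1) * (V ⟨wrap (dbl K) (b.1 + uvec μ), wrap_mem_labels hK _⟩ - V b)) ^ 2 := by ring
      _ = (∑ x ∈ Finset.univ.filter (fun x => rblk L _ x = b), ∑ m ∈ Finset.range L, g (sh m x)) ^ 2 := by rw [hdiff]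
      _ ≤ _ := hCS
  -- (3) sum over blocks; the blocks partition the torus; the shifts are bijections
  have hsumblocks : ∑ b : ↥((boxDom (dbl fun i => L * K i)).image (blk L)),
      ∑ x ∈ Finset.univ.filter (fun x => rblk L _ x = b), ∑ m ∈ Finset.range L, g (sh m x) ^ 2 =
        (L : ℝ) * ∑ x : ↥(boxDom (dbl fun i => L * K i)), g x ^ 2 := by
    rw [Finset.sum_fiberwise_of_maps_to (s := Finset.univ) (t := Finset.univ) (g := rblk L _)
      (fun x _ => Finset.mem_univ _) (fun x => ∑ m ∈ Finset.range L, g (sh m x) ^ 2), Finset.sum_comm]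
    have hm : ∀ m ∈ Finset.range L, ∑ x : ↥(boxDom (dbl fun i => L * K i)), g (sh m x) ^ 2 =
        ∑ x : ↥(boxDom (dbl fun i => L * K i)), g x ^ 2 := fun m _ =>
      sum_shift hP (fun x => g x ^ 2) (fun i => (m : ℤ) * uvec μ i)
    rw [Finset.sum_congr rfl hm, Finset.sum_const, Finset.card_range, nsmul_eq_mul]
  -- (4) assemble and divide by `L^{d+1}`
  have hsum := Finset.sum_le_sum fun b (_ : b ∈ Finset.univ) => hblock b
  rw [← Finset.mul_sum, ← Finset.mul_sum, hsumblocks] at hsum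
  refine le_of_mul_le_mul_left ?_ hLpow
  calc (L : ℝ) ^ (d + 1) * ((L : ℝ) ^ (d + 1) * ∑ b : ↥((boxDom (dbl fun i => L * K i)).image (blk L)),
        (V ⟨wrap (dbl K) (b.1 + uvec μ), wrap_mem_labels hK _⟩ - V b) ^ 2)
      = ((L : ℝ) ^ (d + 1)) ^ 2 * ∑ b : ↥((boxDom (dbl fun i => L * K i)).image (blk L)),
        (V ⟨wrap (dbl K) (b.1 + uvec μ), wrap_mem_labels hK _⟩ - V b) ^ 2 := by ring
    _ ≤ ((L : ℝ) ^ (d + 1) * L) * ((L : ℝ) * ∑ x : ↥(boxDom (dbl fun i => L * K i)), g x ^ 2) := hsum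
    _ = (L : ℝ) ^ (d + 1) * ((L : ℝ) ^ 2 * ∑ x : ↥(boxDom (dbl fun i => L * K i)), g x ^ 2) := by ring

end Jensen

end Summit.QuantumFields.BalabanUV.T4Continuum.NE7K1LinTorusJensen

end
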